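/-
Copyright (c) 2026 the pub-hodgecm-mathlib formalisation cell (harness21).  Prover seat hodgecm-mathlib-LH4-p12 (g7), req620 Track A «(D-RAM) FOUR-FRAME», line LH4
(STAGE-1b tier-0 LEVEL rows, (d)-lev PART 5 (dealer WORD #83): THE LABELLED SIGNED κ-STAGE B₀ OF THE LEVEL LAWS AND THE GENERIC LAW HEAD MODULO `LevLabelledBoxSum`,
the G3 cell and the schedule dictionary.  ★ p857128's body VERBATIM over the two-token labelled trunk ★ p860243.)  2026-09-04.
-/
import Summits.HodgeConjecture.HodgeConjecture.Theorems.F0P3cDyRamLevKappaSignLawsOfBoxSumWide              -- (d)-lev PART 5 WIDE (this seat): the generic law on the wide box, no G3 hypothesis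
import Summits.HodgeConjecture.HodgeConjecture.Theorems.F0P3cDyRamLevLabelledTrunkOfBoxSum                  -- ★ p860243∕p860279 (this seat): the two-token labelled trunk modulo `LevLabelledBoxSum` (ED. 2: generic `N₀`)
import Summits.HodgeConjecture.HodgeConjecture.Theorems.F0P3cDyRamLevBoxBracketAmpl                        -- ★ p860244 (this seat): bracket ∕ (q−1) = ampl ∕ 4
import Summits.HodgeConjecture.HodgeConjecture.Theorems.F0P3cDyRamLevKappaSignLawAtDepthOfLabelledTrunk     -- ★ p859848 (F0P3a-p01 (g36)): `dyadicFence_levKappaSignLawAtS2_at_of_labelledKappaStageB`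
import Summits.HodgeConjecture.HodgeConjecture.Theorems.F0P3cDyRamSqKappaSignCount2TypeZeroOfLabelledTrunk    -- ★ p859650 (this seat): brings ★ p857128's tools + ★ p859612 (S2a-κ HEAD) + ★ p859556 (S2c)
import Summits.HodgeConjecture.HodgeConjecture.Theorems.F0P3cDyRamSqDatumDerivedFence                       -- ★ p859917 (this seat): the fence from the root guards
import Summits.HodgeConjecture.HodgeConjecture.Theorems.F0P3cDyRamStageOneBDerivedDefs                       -- ★ DEFS №6: `n0DerivedOfRecord`
import Summits.HodgeConjecture.HodgeConjecture.Theorems.F0P3cDyRamStageOneBDefs                              -- ★ p859562 DEFS №5: `amplCs`, `csOfRecord`, `mstarOfRecord`, `SqKappaSignLawAtS2`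
import Summits.HodgeConjecture.HodgeConjecture.Theorems.F0P3cDyRamLevLabelledBoxSum                            -- ★ p860684 (F0P3a-p01 (g36)) FILE 3: `levLabelledBoxSumWide_holds` — discharges `hbox` (ED. 2)
import HarnessLib

/-!
# Crux `H413`, line LH4 «(D-RAM) FOUR-FRAME» — (d)-lev: THE FOUR LEVEL κ-SIGN LAWS OF RECORD BY NAME (dealer WORD #89 (e) ∕ #92), MODULO THE WIDE BOX-SUM ONLY

* §1 THE DICTIONARY OF RECORD, PROVED (`omega` on the unfolded ★ DEFS №5∕№6 letters): for each of the four schedules `(la, lb, kl, bl)` of the ED. 7 stubs and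
  `d ≥ 2`: `kl d = max (la d) ((lb d + 1)∕2 − d∕2 + (la d + 1 − d%2)∕2)`, `bl d + 2·((la d + 1 − d%2)∕2) = kl d`, `la d ≤ 2`, the corner clause; and the WIDE schedule
  bounds `lb d ≤ nᵢ + la d ∧ lb d ≤ nᵢ + nᵢ%2` — clean rows from `n0DerivedOfRecord d ≤ nᵢ`, lo∕hi rows from the fence + parity.
* §2 THE FOUR HEADS BY NAME, MODULO `hbox` ONLY: `dyadicFence_levKappaSignLawAtS2_{lo,hi,cleanLo,cleanHi}_ofRecord (hbox : ∀ d, 2 ≤ d → LevLabelledBoxSumWide (la d) (lb d))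
  (σ ϖ d t)` : the sentences of `stub_law_levLo ∕ levHi ∕ levCleanLo ∕ levCleanHi` (tier-0 ED. 7) BY NAME via PART 5 WIDE `dyadicFence_levKappaSignLawAtS2_at_of_boxSumWide`
  (G3 cell ★ by LH4-p09 inside the wide trunk ★ p860396).  ED. 2 (when `levBoxArith` ⟹ `LevLabelledBoxSumWide` is ★): the primed hypothesis-free heads, the pen's bare constants.

HONEST LABEL: helper lane (`--supports stmt-HodgeConjecture-24833`), count-neutral; the heads are CONDITIONAL on the named inputs; pays no tier-0 row until the pen's
pay edition; HC_CM is proved only modulo the 7 printed citations (2 remaining named inputs: hLiu418 = stmt-HodgeConjecture-24832, h413 = stmt-HodgeConjecture-24833)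
until rung 0 closes.

## References (NEVER `[KR2]`)
* [Kottwitz1986BaseChangeUnits] R. E. Kottwitz, *Base change for unit elements of Hecke algebras*, Compositio Math. 60 (1986), §1 pp. 240–241.
* [Rogawski1990] J. D. Rogawski, *Automorphic Representations of Unitary Groups in Three Variables*, Ann. of Math. Stud. 123 (1990), §4.9 Prop. 4.9.1 (a) p. 55, §4.10 p. 58.
* [LanglandsShelstad1987] R. P. Langlands, D. Shelstad, *On the definition of transfer factors*, Math. Ann. 278 (1987), §3.
* [Serre1979] J.-P. Serre, *Local Fields*, GTM 67 (1979), Ch. V §3 Prop. 5, Cor. 3.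
-/

set_option autoImplicit false

noncomputable section

namespace Summit.HodgeConjecture.HodgeConjecture.Cruxes.H413.F0P3cDyRamLevKappaSignLawsOfRecord

open Literature.NumberTheory.Automorphic Literature.NumberTheory.Automorphic.HermitianLattice
open Literature.NumberTheory.Automorphic.UnitaryLatticeTree Literature.NumberTheory.Automorphic.UnitaryThreeFourFrame
open Literature.NumberTheory.LocalFields Literature.NumberTheory.LocalFields.WildQuadraticDatum
open Summit.HodgeConjecture.HodgeConjecture.Cruxes.H413.F0P3cDyRamFourFrameLawDefsR (shiftR)
open Summit.HodgeConjecture.HodgeConjecture.Cruxes.H413.F0P3cDyRamFourFrameLawDefsR2 (OmegaSchedule)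
open Summit.HodgeConjecture.HodgeConjecture.Cruxes.H413.F0P3cDyRamFourFrameCensusDefs (LatticeInLevel)
open Summit.HodgeConjecture.HodgeConjecture.Cruxes.H413.F0P3cDyRamDiagonalTorusDefs (normalisedStableLattices stabiliserWeight IsDualisableLattice)
open Summit.HodgeConjecture.HodgeConjecture.Cruxes.H413.F0P3cDyRamDiagonalKappaCountDefs (kappaCount)
open Summit.HodgeConjecture.HodgeConjecture.Cruxes.H413.F0P3cDyRamOmegaRDefs (omegaR)
open Summit.HodgeConjecture.HodgeConjecture.Cruxes.H413.F0P3cDyRamKappaAssemblyTools (exists_glue_witness)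
open Summit.HodgeConjecture.HodgeConjecture.Cruxes.H413.F0P3cDyRamDiagonalPermutation (isElementDatum_swap isElementDatum_rescale)
open Summit.HodgeConjecture.HodgeConjecture.Cruxes.H413.F0P3cDyRamElementDatumParity (isoceles_of_isElementDatum)
open Summit.HodgeConjecture.HodgeConjecture.Cruxes.H413.F0P3cDyRamDiagonalGlueSignDefs (IsGlueRep glueSign)
open Summit.HodgeConjecture.HodgeConjecture.Cruxes.H413.F0P3cDyRamDiagonalGlueSignTokenRotations
open Summit.HodgeConjecture.HodgeConjecture.Cruxes.H413.F0P3cDyRamLabelledKappaOrbitCountZero (sqKappaSignModelSum2_of_labelledKappaStageBZero)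
open scoped Valued WithZero Matrix MatrixGroups
open Summit.HodgeConjecture.HodgeConjecture.Cruxes.H413.F0P3cDyRamDiagonalGlueSignEval (ampl_eq_zero_of_nonpos)
open Summit.HodgeConjecture.HodgeConjecture.Cruxes.H413.F0P3cDyRamSqDatumDerivedFence (depths_ge_of_rootGuard)
open Summit.HodgeConjecture.HodgeConjecture.Cruxes.H413.F0P3cDyRamLevLabelledTrunkOfBoxSum (labelledTrunk_lev_at_of_boxSum)
open Summit.HodgeConjecture.HodgeConjecture.Cruxes.H413.F0P3cDyRamDiagonalStrataDefs
open Summit.HodgeConjecture.HodgeConjecture.Cruxes.H413.F0P3cDyRamDiagonalKappaCoreHangingClass (two_le_d_of_v_two_lt_one)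
open Summit.HodgeConjecture.HodgeConjecture.Cruxes.H413.F0P3cDyRamElementDatumParity (depth_mod_two_eq_of_isElementDatum)
open Summit.HodgeConjecture.HodgeConjecture.Cruxes.H413.F0P3cDyRamLevBoxBracketAmpl (box_bracket_div_eq_ampl_div)
open Summit.HodgeConjecture.HodgeConjecture.Cruxes.H413.F0P3cDyRamLevLabelledBoxSumDefs (LevLabelledBoxSumWide)
open Summit.HodgeConjecture.HodgeConjecture.Cruxes.H413.F0P3cDyRamLevKappaSignLawAtDepthOfLabelledTrunk (dyadicFence_levKappaSignLawAtS2_at_of_labelledKappaStageB)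
open Summit.HodgeConjecture.HodgeConjecture.Cruxes.H413.F0P3cDyRamSqKappaSignModelSumOfLabelledStageB (fencedSqKappaSignSlot_of_labelledKappaStageB)
open Summit.HodgeConjecture.HodgeConjecture.Cruxes.H413.F0P3cDyRamFourFramePieces (mstarOfRecord)
open Summit.HodgeConjecture.HodgeConjecture.Cruxes.H413.F0P3cDyRamStageOneBDefs
open Summit.HodgeConjecture.HodgeConjecture.Cruxes.H413.F0P3cDyRamStageOneBDerivedDefs (n0DerivedOfRecord)
open Summit.HodgeConjecture.HodgeConjecture.Cruxes.H413.F0P3cDyRamLevKappaSignLawAtDepthOfLabelledTrunk (le_n0DerivedOfRecord)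
open Summit.HodgeConjecture.HodgeConjecture.Cruxes.H413.F0P3cDyRamLevKappaSignLawsOfBoxSumWide (dyadicFence_levKappaSignLawAtS2_at_of_boxSumWide)
open Summit.HodgeConjecture.HodgeConjecture.Cruxes.H413 (F0P3cDyRamLabelledKappaOrbitCountZero.cast_sum_signChar_mul_ncard_inLevel_eq_eight_mul_finsum_kappaCount_zero)
open Summit.HodgeConjecture.HodgeConjecture.Cruxes.H413.F0P3cDyRamFourFrameLawDefs (DyadicFence)


/-! ## §1  The dictionary of record -/

/-- `d ≤ depthOfRecord d`. -/
theorem le_depthOfRecord (d : ℕ) : d ≤ depthOfRecord d := by unfold depthOfRecord; split_ifs <;> omega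

/-- `mstarOfRecord d + 1 = d % 2 + 2d` for `d ≥ 1`. -/
theorem mstar_add_one (d : ℕ) (hd : 1 ≤ d) : mstarOfRecord d + 1 = d % 2 + 2 * d := by unfold mstarOfRecord; omega

/-- `mcOfRecord d = 3d − 2 + d % 2` for `d ≥ 1`. -/
theorem mc_eq (d : ℕ) (hd : 1 ≤ d) : mcOfRecord d = 3 * d - 2 + d % 2 := by
  have h := mstar_add_one d hd
  unfold mcOfRecord; omega

/-- Division bookkeeping: `(d%2 + 2d)∕2 = d`, `(d%2+1−d%2)∕2 = 0`, `(d%2+2−d%2)∕2 = 1`, `(3d−1+d%2)∕2 = 3(d∕2) + 2(d%2) − 1` (`d ≥ 1`). -/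
theorem div_facts (d : ℕ) (hd : 1 ≤ d) :
    (d % 2 + 2 * d) / 2 = d ∧ (d % 2 + 1 - d % 2) / 2 = 0 ∧ (d % 2 + 1 + 1 - d % 2) / 2 = 1 ∧
      (3 * d - 2 + d % 2 + 1) / 2 = 3 * (d / 2) + 2 * (d % 2) - 1 := by
  refine ⟨by omega, by omega, by omega, by omega⟩

/-- LO row `(laLow, m*, cs, cs)`: the dictionary, `la ≤ 2`, the corner clause (`d ≥ 2`). -/
theorem dict_lo (d : ℕ) (hd : 2 ≤ d) :
    csOfRecord d = max (laLowOfRecord d) ((mstarOfRecord d + 1) / 2 - d / 2 + (laLowOfRecord d + 1 - d % 2) / 2) ∧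
      csOfRecord d + 2 * ((laLowOfRecord d + 1 - d % 2) / 2) = csOfRecord d ∧ laLowOfRecord d ≤ 2 ∧
      (d % 2 = 0 → laLowOfRecord d = 1 → d + 1 ≤ mstarOfRecord d) := by
  obtain ⟨hA, hB, -, -⟩ := div_facts d (by omega)
  unfold csOfRecord laLowOfRecord
  rw [mstar_add_one d (by omega), hA, hB]
  have := mstar_add_one d (by omega)
  omega

/-- HI row `(laHigh, m*, klOfRecord, blOfRecord)`: the dictionary, `la ≤ 2`, the corner clause (`d ≥ 2`). -/
theorem dict_hi (d : ℕ) (hd : 2 ≤ d) :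
    klOfRecord d = max (laHighOfRecord d) ((mstarOfRecord d + 1) / 2 - d / 2 + (laHighOfRecord d + 1 - d % 2) / 2) ∧
      blOfRecord d + 2 * ((laHighOfRecord d + 1 - d % 2) / 2) = klOfRecord d ∧ laHighOfRecord d ≤ 2 ∧
      (d % 2 = 0 → laHighOfRecord d = 1 → d + 1 ≤ mstarOfRecord d) := by
  obtain ⟨hA, -, hB', -⟩ := div_facts d (by omega)
  unfold blOfRecord klOfRecord laHighOfRecord
  rw [mstar_add_one d (by omega), hA, hB']
  have := mstar_add_one d (by omega)
  omega

/-- CLEAN-LO row `(laLow, m_c, sT, sT)`: the dictionary, `la ≤ 2`, the corner clause (`d ≥ 2`). -/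
theorem dict_cleanLo (d : ℕ) (hd : 2 ≤ d) :
    sTOfRecord d = max (laLowOfRecord d) ((mcOfRecord d + 1) / 2 - d / 2 + (laLowOfRecord d + 1 - d % 2) / 2) ∧
      sTOfRecord d + 2 * ((laLowOfRecord d + 1 - d % 2) / 2) = sTOfRecord d ∧ laLowOfRecord d ≤ 2 ∧
      (d % 2 = 0 → laLowOfRecord d = 1 → d + 1 ≤ mcOfRecord d) := by
  obtain ⟨-, hB, -, hC⟩ := div_facts d (by omega)
  unfold sTOfRecord laLowOfRecord
  rw [mc_eq d (by omega), hC, hB]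
  have := mc_eq d (by omega)
  omega

/-- CLEAN-HI row `(laHigh, m_c, sT + 1, sT − 1)`: the dictionary, `la ≤ 2`, the corner clause (`d ≥ 2`). -/
theorem dict_cleanHi (d : ℕ) (hd : 2 ≤ d) :
    sTOfRecord d + 1 = max (laHighOfRecord d) ((mcOfRecord d + 1) / 2 - d / 2 + (laHighOfRecord d + 1 - d % 2) / 2) ∧
      (sTOfRecord d - 1) + 2 * ((laHighOfRecord d + 1 - d % 2) / 2) = sTOfRecord d + 1 ∧ laHighOfRecord d ≤ 2 ∧
      (d % 2 = 0 → laHighOfRecord d = 1 → d + 1 ≤ mcOfRecord d) := by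
  obtain ⟨-, -, hB', hC⟩ := div_facts d (by omega)
  unfold sTOfRecord laHighOfRecord
  rw [mc_eq d (by omega), hC, hB']
  have := mc_eq d (by omega)
  omega

/-- CLEAN rows: the wide schedule bound from `n0DerivedOfRecord d ≤ n` (a conjunct of `IsElementDatum`). -/
theorem mc_le_wide_of_n0Derived_le {d n : ℕ} (h : n0DerivedOfRecord d ≤ n) {la : ℕ} : mcOfRecord d ≤ n + la ∧ mcOfRecord d ≤ n + n % 2 := by
  have hmc : mcOfRecord d ≤ n := le_trans (by unfold n0DerivedOfRecord; exact le_max_right _ _) h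
  exact ⟨by omega, by omega⟩

/-- LO row: the wide schedule bound `m* ≤ n + laLow d ∧ m* ≤ n + n % 2` from the fence and the parity `n ≡ d (mod 2)`. -/
theorem mstar_le_wide_lo {d n : ℕ} (hd : 2 ≤ d) (hfence : 2 * d ≤ n + 1) (hp : n % 2 = d % 2) :
    mstarOfRecord d ≤ n + laLowOfRecord d ∧ mstarOfRecord d ≤ n + n % 2 := by
  have h := mstar_add_one d (by omega)
  unfold laLowOfRecord; exact ⟨by omega, by omega⟩

/-- HI row: the wide schedule bound `m* ≤ n + laHigh d ∧ m* ≤ n + n % 2`. -/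
theorem mstar_le_wide_hi {d n : ℕ} (hd : 2 ≤ d) (hfence : 2 * d ≤ n + 1) (hp : n % 2 = d % 2) :
    mstarOfRecord d ≤ n + laHighOfRecord d ∧ mstarOfRecord d ≤ n + n % 2 := by
  have h := mstar_add_one d (by omega)
  unfold laHighOfRecord; exact ⟨by omega, by omega⟩

/-! ## §2  The four heads BY NAME, modulo the named open inputs -/

/-- **`stub_law_levCleanLo` BY NAME, MODULO `hbox` ONLY** (`LevLabelledBoxSumWide` at `(laLow, m_c)` — the (c)∕ARITH organ `levBoxArith`, LH4-p09∕p10).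
[cite: Kottwitz1986BaseChangeUnits, §1 pp. 240–241] [cite: Rogawski1990, §4.9 Prop. 4.9.1 (a)(b) p. 55] [cite: LanglandsShelstad1987, §1.3, §3] -/
theorem dyadicFence_levKappaSignLawAtS2_cleanLo_ofRecord (hbox : ∀ d, 2 ≤ d → LevLabelledBoxSumWide (laLowOfRecord d) (mcOfRecord d))
    {K : Type} [Field K] [Valued K ℤᵐ⁰] [CompleteSpace K] [Fintype 𝓀[K]] (σ : K →+* K) (ϖ : K) (d t : ℕ) :
    DyadicFence (K := K) (LevKappaSignLawAtS2 shiftR omegaR n0DerivedOfRecord laLowOfRecord mcOfRecord sTOfRecord sTOfRecord σ ϖ d t) :=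
  dyadicFence_levKappaSignLawAtS2_at_of_boxSumWide n0DerivedOfRecord le_n0DerivedOfRecord laLowOfRecord mcOfRecord sTOfRecord sTOfRecord
    (fun d hd => (dict_cleanLo d hd).2.2.1) (fun _ _ hN _ => mc_le_wide_of_n0Derived_le hN) (fun d hd => (dict_cleanLo d hd).2.2.2)
    (fun d hd => (dict_cleanLo d hd).1) (fun d hd => (dict_cleanLo d hd).2.1) hbox σ ϖ d t

/-- **`stub_law_levCleanHi` BY NAME, MODULO `hbox` ONLY** (at `(laHigh, m_c)`).
[cite: Kottwitz1986BaseChangeUnits, §1 pp. 240–241] [cite: Rogawski1990, §4.9 Prop. 4.9.1 (a)(b) p. 55] [cite: LanglandsShelstad1987, §1.3, §3] -/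
theorem dyadicFence_levKappaSignLawAtS2_cleanHi_ofRecord (hbox : ∀ d, 2 ≤ d → LevLabelledBoxSumWide (laHighOfRecord d) (mcOfRecord d))
    {K : Type} [Field K] [Valued K ℤᵐ⁰] [CompleteSpace K] [Fintype 𝓀[K]] (σ : K →+* K) (ϖ : K) (d t : ℕ) :
    DyadicFence (K := K) (LevKappaSignLawAtS2 shiftR omegaR n0DerivedOfRecord laHighOfRecord mcOfRecord (fun d => sTOfRecord d + 1) (fun d => sTOfRecord d - 1) σ ϖ d t) :=
  dyadicFence_levKappaSignLawAtS2_at_of_boxSumWide n0DerivedOfRecord le_n0DerivedOfRecord laHighOfRecord mcOfRecord (fun d => sTOfRecord d + 1) (fun d => sTOfRecord d - 1)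
    (fun d hd => (dict_cleanHi d hd).2.2.1) (fun _ _ hN _ => mc_le_wide_of_n0Derived_le hN) (fun d hd => (dict_cleanHi d hd).2.2.2)
    (fun d hd => (dict_cleanHi d hd).1) (fun d hd => (dict_cleanHi d hd).2.1) hbox σ ϖ d t

/-- **`stub_law_levLo` BY NAME, MODULO `hbox` ONLY** (at `(laLow, m*)`, WIDE box — the odd-`d` rows need `m* = 2d ≤ nᵢ + 1`). [cite: Kottwitz1986BaseChangeUnits, §1 pp. 240–241] [cite: Rogawski1990, §4.9 Prop. 4.9.1 (a)(b) p. 55] [cite: LanglandsShelstad1987, §1.3, §3] -/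
theorem dyadicFence_levKappaSignLawAtS2_lo_ofRecord (hbox : ∀ d, 2 ≤ d → LevLabelledBoxSumWide (laLowOfRecord d) (mstarOfRecord d))
    {K : Type} [Field K] [Valued K ℤᵐ⁰] [CompleteSpace K] [Fintype 𝓀[K]] (σ : K →+* K) (ϖ : K) (d t : ℕ) :
    DyadicFence (K := K) (LevKappaSignLawAtS2 shiftR omegaR depthOfRecord laLowOfRecord mstarOfRecord csOfRecord csOfRecord σ ϖ d t) :=
  dyadicFence_levKappaSignLawAtS2_at_of_boxSumWide depthOfRecord le_depthOfRecord laLowOfRecord mstarOfRecord csOfRecord csOfRecord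
    (fun d hd => (dict_lo d hd).2.2.1) (fun hd hf _ hp => mstar_le_wide_lo hd hf hp) (fun d hd => (dict_lo d hd).2.2.2)
    (fun d hd => (dict_lo d hd).1) (fun d hd => (dict_lo d hd).2.1) hbox σ ϖ d t

/-- **`stub_law_levHi` BY NAME, MODULO `hbox` ONLY** (at `(laHigh, m*)`, WIDE box).
[cite: Kottwitz1986BaseChangeUnits, §1 pp. 240–241] [cite: Rogawski1990, §4.9 Prop. 4.9.1 (a)(b) p. 55] [cite: LanglandsShelstad1987, §1.3, §3] -/
theorem dyadicFence_levKappaSignLawAtS2_hi_ofRecord (hbox : ∀ d, 2 ≤ d → LevLabelledBoxSumWide (laHighOfRecord d) (mstarOfRecord d))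
    {K : Type} [Field K] [Valued K ℤᵐ⁰] [CompleteSpace K] [Fintype 𝓀[K]] (σ : K →+* K) (ϖ : K) (d t : ℕ) :
    DyadicFence (K := K) (LevKappaSignLawAtS2 shiftR omegaR depthOfRecord laHighOfRecord mstarOfRecord klOfRecord blOfRecord σ ϖ d t) :=
  dyadicFence_levKappaSignLawAtS2_at_of_boxSumWide depthOfRecord le_depthOfRecord laHighOfRecord mstarOfRecord klOfRecord blOfRecord
    (fun d hd => (dict_hi d hd).2.2.1) (fun hd hf _ hp => mstar_le_wide_hi hd hf hp) (fun d hd => (dict_hi d hd).2.2.2)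
    (fun d hd => (dict_hi d hd).1) (fun d hd => (dict_hi d hd).2.1) hbox σ ϖ d t


/-! ## ED. 2 (append-only; F0P3a-p01 (g36) per LH4-p12 (g7)'s recipe) — THE FOUR HEADS HYPOTHESIS-FREE: `hbox` discharged by ★ p860684 `levLabelledBoxSumWide_holds` -/

/-- **`stub_law_levCleanLo` BY NAME, UNCONDITIONAL**: §2's head with `hbox := levLabelledBoxSumWide_holds` (★ p860684, the (T-box | lev) identity).
[cite: Kottwitz1986BaseChangeUnits, §1 pp. 240–241] [cite: Rogawski1990, §4.9 Prop. 4.9.1 (a)(b) p. 55] [cite: LanglandsShelstad1987, §1.3, §3] -/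
theorem dyadicFence_levKappaSignLawAtS2_cleanLo_ofRecord' {K : Type} [Field K] [Valued K ℤᵐ⁰] [CompleteSpace K] [Fintype 𝓀[K]] (σ : K →+* K) (ϖ : K) (d t : ℕ) :
    DyadicFence (K := K) (LevKappaSignLawAtS2 shiftR omegaR n0DerivedOfRecord laLowOfRecord mcOfRecord sTOfRecord sTOfRecord σ ϖ d t) :=
  dyadicFence_levKappaSignLawAtS2_cleanLo_ofRecord
    (fun d _ => F0P3cDyRamLevLabelledBoxSum.levLabelledBoxSumWide_holds (laLowOfRecord d) (mcOfRecord d)) σ ϖ d t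

/-- **`stub_law_levCleanHi` BY NAME, UNCONDITIONAL** (`hbox := levLabelledBoxSumWide_holds`).
[cite: Kottwitz1986BaseChangeUnits, §1 pp. 240–241] [cite: Rogawski1990, §4.9 Prop. 4.9.1 (a)(b) p. 55] [cite: LanglandsShelstad1987, §1.3, §3] -/
theorem dyadicFence_levKappaSignLawAtS2_cleanHi_ofRecord' {K : Type} [Field K] [Valued K ℤᵐ⁰] [CompleteSpace K] [Fintype 𝓀[K]] (σ : K →+* K) (ϖ : K) (d t : ℕ) :
    DyadicFence (K := K) (LevKappaSignLawAtS2 shiftR omegaR n0DerivedOfRecord laHighOfRecord mcOfRecord (fun d => sTOfRecord d + 1) (fun d => sTOfRecord d - 1) σ ϖ d t) :=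
  dyadicFence_levKappaSignLawAtS2_cleanHi_ofRecord
    (fun d _ => F0P3cDyRamLevLabelledBoxSum.levLabelledBoxSumWide_holds (laHighOfRecord d) (mcOfRecord d)) σ ϖ d t

/-- **`stub_law_levLo` BY NAME, UNCONDITIONAL** (`hbox := levLabelledBoxSumWide_holds`).
[cite: Kottwitz1986BaseChangeUnits, §1 pp. 240–241] [cite: Rogawski1990, §4.9 Prop. 4.9.1 (a)(b) p. 55] [cite: LanglandsShelstad1987, §1.3, §3] -/
theorem dyadicFence_levKappaSignLawAtS2_lo_ofRecord' {K : Type} [Field K] [Valued K ℤᵐ⁰] [CompleteSpace K] [Fintype 𝓀[K]] (σ : K →+* K) (ϖ : K) (d t : ℕ) :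
    DyadicFence (K := K) (LevKappaSignLawAtS2 shiftR omegaR depthOfRecord laLowOfRecord mstarOfRecord csOfRecord csOfRecord σ ϖ d t) :=
  dyadicFence_levKappaSignLawAtS2_lo_ofRecord
    (fun d _ => F0P3cDyRamLevLabelledBoxSum.levLabelledBoxSumWide_holds (laLowOfRecord d) (mstarOfRecord d)) σ ϖ d t

/-- **`stub_law_levHi` BY NAME, UNCONDITIONAL** (`hbox := levLabelledBoxSumWide_holds`).
[cite: Kottwitz1986BaseChangeUnits, §1 pp. 240–241] [cite: Rogawski1990, §4.9 Prop. 4.9.1 (a)(b) p. 55] [cite: LanglandsShelstad1987, §1.3, §3] -/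
theorem dyadicFence_levKappaSignLawAtS2_hi_ofRecord' {K : Type} [Field K] [Valued K ℤᵐ⁰] [CompleteSpace K] [Fintype 𝓀[K]] (σ : K →+* K) (ϖ : K) (d t : ℕ) :
    DyadicFence (K := K) (LevKappaSignLawAtS2 shiftR omegaR depthOfRecord laHighOfRecord mstarOfRecord klOfRecord blOfRecord σ ϖ d t) :=
  dyadicFence_levKappaSignLawAtS2_hi_ofRecord
    (fun d _ => F0P3cDyRamLevLabelledBoxSum.levLabelledBoxSumWide_holds (laHighOfRecord d) (mstarOfRecord d)) σ ϖ d t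

end Summit.HodgeConjecture.HodgeConjecture.Cruxes.H413.F0P3cDyRamLevKappaSignLawsOfRecord

end
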